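import Summits.QuantumFields.YangMills.Theorems.BalabanUVNodesK0FlatHPinnedExteriorLocality
import Literature.MathematicalPhysics.QuantumFieldTheory.Balaban1983to89.Node00.CriticalOnFibre
import HarnessLib

/-!
# N07 [B11] ∕ K0⁷ road, chart side — MODULE 105: **THREE DICTIONARY LEMMAS FOR THE (d′) DISCHARGE** — (a) the ♭ chart is ONTO near `0`: every small `A` is a charted point
# `A = A′ − H·Dsel A′` with `A′ := A + H·C(A)` (print's (49)–(50) uniqueness); (b) print's curve-criticality in the `critLam` form ⇒ the `HasDerivAt … 0 0` form the k0-s1 chart core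
# consumes; (c) `R∂*H = 0` read through a matrix kernel: adding `H·Z` to a potential does not move its (153) slice rows

Cell `pub-ymgap`, seat `pub-ymgap-dag-n07-e` g29 (FAN-OUT §N07 row s3; LANE OWNER of the K0 road chart side), MODULE 105 = repair (R3)(a)–(c) of ⚑ LOCATED-DPRIME-CALIBRATION (desk
memo 2026-08-29).  `--kind proof --supports stmt-QuantumFields-20541 --as helper` (K0⁷); count-neutral; theorems only.  [15] = [Balaban1985Variational]; [B6] = [Balaban1984PropagatorsII].

WHY.  The (d′) letter of the head token is about the record's potential `A` (`U^u = e^{iηA}` on the tower), while its supplier (k0-s1 S4, to be re-cut in cell form) is about a chart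
parameter `A′` whose charted point `A′ − H·Dsel A′` is read by the configuration.  (a) Print's (49)–(50) ([15] p. 285: the fixed point `D(A′)` of `D = C(A′ − HD)` is UNIQUE in the
small ball) make the chart onto: for `A` small, `A′ := A + H·C(A)` has `C(A′ − H·C(A)) = C(A)`, so `C(A)` is THE fixed point at `A′`, `Dsel A′ = C(A)` and `A′ − H·Dsel A′ = A` — stated
over the conclusion rows of the cell's `Chart47Analytic.exists_analytic_chart47W` (the (50) row is the one S4 does not re-export; S4-Lam will).  (b) The k0-s1 chart core
(`…K0Stub1FlatChartLineStationarity.hasDerivAt_wilsonAction4_zero_of_flatChart_line_critical`) consumes criticality as «every bondwise-differentiable curve through `U` preserving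
all cell averages for all `t` has `(𝔄 ∘ γ)′(0) = 0`»; MODULES 101–104 deliver the `critLam` form («… for `t` near `0`, every derivative at `0` vanishes»); the derivative exists along
every such curve (`Node00.differentiableAt_wilsonAction4_along`), so the forms agree.  (c) [15] (45)∕[B6] (2.34) `R∂*H = 0` (the tree's `FlatCubeOperators.RE_dsE_hOp`) read
through the matrix kernel `H X b = Σ_t κ_t·flatH(𝟙_t)(b)•X t` of the head token's `H_V`: for every `ℂ`-linear functional `φ`, the real row `b ↦ Re φ(H X b)` is `flatH` of a real
vector, so its `R∂*` vanishes; hence `A` and `A + H·Z` have the same (153) slice rows — the slice hypothesis of S4 at `A′` follows from the head token's slice rows of `A`.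

WHAT IS PROVED (sorry-free; no definition; axioms standard).  §1 ★★ `exists_chart_preimage_of_unique` (abstract normed spaces: weights `w₀`, `wB`, the row of `H`, the quadratic
bound of `C`, the (50) uniqueness row ⟹ for `A` with `w₀-size ≤ ε′`, `ε′ + B₀C₂ε′² < ε`, `ε′ < R`, `ε′ ≤ 2ε`: `A′ := A + H(C A)` lies in the `ε`-ball, `Dsel A′ = C A`, `A′ − H(Dsel A′) = A`).
§2 ★ `hasDerivAt_zero_form_of_critLam` (cell-form curve-criticality, `∀ᶠ` version ⇒ the k0-s1 core's `∀ t`-fibre ∕ `HasDerivAt … 0 0` version, any level guard).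
§3 `re_apply_kernelH_eq_flatH` (the real row of a matrix-kernel `H` is `flatH` of a real vector), ★★ `RE_dsE_re_kernelH_eq_zero` ((45) for matrix kernels), ★★ `RE_dsE_re_add_kernelH`
(slice rows of `A + H·Z` = slice rows of `A`, both for `Re φ` and `Im φ` via `φ ↦ −i•φ`).
HONEST FRAMING: linear algebra ∕ one-variable calculus by name; NOTHING of [15]'s estimates asserted; (d′) ∕ `HThm4RecDbar` ∕ budget row of MODULE 100 untouched; K0⁷ NOT closed;
N07 NOT discharged; counts unmoved; one finite 𝕋⁴ programme at fixed ε — NOT continuum ∕ ℝ⁴ ∕ OS ∕ mass gap ∕ Clay.  No `sorry`, no `def`, no `instance`, no `notation`.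

References: [15] (44)–(50) p.285, (55) p.286, (45) p.285, (152)–(153) p.301, (157)–(159) pp.302–303; [B6] (2.34)–(2.35) p.228, (2.3) p.224.
-/

set_option autoImplicit false

noncomputable section

open scoped Matrix.Norms.L2Operator Topology BigOperators
open Filter

namespace Summit.QuantumFields.YangMills.BalabanUVNodes.N07DPrimeChartDictionary

open Literature.MathematicalPhysics.QuantumFieldTheory.Balaban1983to89
open Literature.MathematicalPhysics.QuantumFieldTheory.Balaban1983to89.T4Continuum (T4Family)
open Literature.MathematicalPhysics.QuantumFieldTheory.Balaban1983to89.B15DeterminingSets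
open Literature.MathematicalPhysics.QuantumFieldTheory.Balaban1983to89.B6SectADomainsV1 (Domains)
open Literature.MathematicalPhysics.QuantumFieldTheory.Balaban1983to89.B6SectAOperatorsV1 (BondIdx BondIdxSpace QE QsE RE dsE)
open Literature.MathematicalPhysics.QuantumFieldTheory.Balaban1983to89.B6SectAVectorModelV1 (GE EE)
open Literature.MathematicalPhysics.QuantumFieldTheory.Balaban1983to89.B6SectA (hOp)
open Literature.MathematicalPhysics.QuantumFieldTheory.BalabanImbrieJaffe1984to88.BIJ85AxialPropagator411 (BondSpace)
open Literature.MathematicalPhysics.QuantumFieldTheory.Balaban1983to89.Node00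
open Summit.QuantumFields.YangMills.Theorems.K0FlatCubeOpsTextP (flatH)
open Summit.QuantumFields.YangMills.Theorems.FlatCubeOperators (RE_dsE_hOp)

/-! ## §1  The ♭ chart is onto near `0` (print's (49)–(50)) -/

section Preimage

variable {ι β V : Type*} [NormedAddCommGroup V] [NormedSpace ℂ V]

/-- ★★ **EVERY SMALL `A` IS A CHARTED POINT**: with the row of `H` (`‖HX‖_{w₀} ≤ B₀‖X‖_{wB}`), the quadratic bound of `C` below `R`, and the (50) uniqueness row of the selector
`Dsel` on the `ε`-ball, every `A` of `w₀`-size `≤ ε′` with `ε′ + B₀C₂ε′² < ε`, `ε′ < R`, `C₂ε′² ≤ 4C₂ε²` has the preimage `A′ := A + H(C A)`: it lies in the `ε`-ball, `Dsel A′ = C A`,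
and `A′ − H(Dsel A′) = A`. [cite: Balaban1985Variational, (44)–(50) p.285, (55) p.286, (159) p.303] -/
theorem exists_chart_preimage_of_unique {w₀ : ι → ℝ} {wB : β → ℝ} (hw₀ : ∀ i, 0 < w₀ i)
    (C : (ι → V) → (β → V)) (H : (β → V) →ₗ[ℂ] (ι → V)) (Dsel : (ι → V) → (β → V)) {C₂ R B₀ ε ε' : ℝ}
    (hH : ∀ (X : β → V) (t : ℝ), 0 ≤ t → (∀ c, wB c * ‖X c‖ ≤ t) → ∀ i, w₀ i * ‖H X i‖ ≤ B₀ * t)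
    (hCq : ∀ (Y : ι → V) (r : ℝ), r < R → (∀ i, w₀ i * ‖Y i‖ ≤ r) → ∀ c, wB c * ‖C Y c‖ ≤ C₂ * r ^ 2)
    (h50 : ∀ A' : ι → V, (∀ i, w₀ i * ‖A' i‖ < ε) →
      ∀ D' : β → V, (∀ c, wB c * ‖D' c‖ ≤ 4 * C₂ * ε ^ 2) → C (A' - H D') = D' → D' = Dsel A')
    (hε'R : ε' < R) (hε'ε : ε' + B₀ * (C₂ * ε' ^ 2) < ε) (h4 : C₂ * ε' ^ 2 ≤ 4 * C₂ * ε ^ 2) (hC₂ε' : 0 ≤ C₂ * ε' ^ 2)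
    {A : ι → V} (hA : ∀ i, w₀ i * ‖A i‖ ≤ ε') :
    (∀ i, w₀ i * ‖(A + H (C A)) i‖ < ε) ∧ Dsel (A + H (C A)) = C A ∧ (A + H (C A)) - H (Dsel (A + H (C A))) = A := by
  -- the size of `C A` and of `H (C A)`
  have hCA : ∀ c, wB c * ‖C A c‖ ≤ C₂ * ε' ^ 2 := hCq A ε' hε'R hA
  have hHCA : ∀ i, w₀ i * ‖H (C A) i‖ ≤ B₀ * (C₂ * ε' ^ 2) := hH (C A) _ hC₂ε' hCA
  -- `A′` lies in the `ε`-ball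
  have hball : ∀ i, w₀ i * ‖(A + H (C A)) i‖ < ε := by
    intro i
    have h1 : w₀ i * ‖(A + H (C A)) i‖ ≤ w₀ i * ‖A i‖ + w₀ i * ‖H (C A) i‖ := by
      rw [Pi.add_apply, ← mul_add]
      exact mul_le_mul_of_nonneg_left (norm_add_le _ _) (hw₀ i).le
    linarith [hA i, hHCA i]
  -- `C A` is the (49) fixed point at `A′`, hence `Dsel A′` by (50)
  have hfix : C ((A + H (C A)) - H (C A)) = C A := by rw [add_sub_cancel_right]
  have hsel : C A = Dsel (A + H (C A)) := h50 _ hball (C A) (fun c => (hCA c).trans h4) hfix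
  refine ⟨hball, hsel.symm, ?_⟩
  rw [← hsel, add_sub_cancel_right]

end Preimage

/-! ## §2  The `critLam` form implies the k0-s1 core's `HasDerivAt … 0 0` form -/

section Forms

variable {F : T4Family} {N : ℕ} [NeZero N] {K : ℕ}

/-- ★ **CELL-FORM CURVE-CRITICALITY, `∀ᶠ` VERSION ⇒ `∀ t` ∕ `HasDerivAt … 0 0` VERSION** (the hypothesis shape of k0-s1-w1's
`hasDerivAt_wilsonAction4_zero_of_flatChart_line_critical`, any level guard `P j`): the derivative of the action exists along every bondwise-differentiable curve
(`Node00.differentiableAt_wilsonAction4_along`) and the `critLam` form forces it to vanish. [cite: Balaban1985Variational, (5)–(6) p.278, Prop. 8 p.304; Balaban1984PropagatorsII, (2.3) p.224] -/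
theorem hasDerivAt_zero_form_of_critLam (D : Domains (F.P K)) {U : GaugeField (F.P K) 0 (SU N)} (Pj : ℕ → Prop)
    (hcrit : ∀ γ : ℝ → GaugeField (F.P K) 0 (SU N), γ 0 = U →
      DifferentiableAt ℝ (fun (t : ℝ) (b : PBond (F.P K) 0) => ((γ t b : SU N) : Matrix (Fin N) (Fin N) ℂ)) 0 →
        (∀ᶠ t in 𝓝 (0 : ℝ), ∀ (j : ℕ) (c : PBond (F.P K) j), D.LamBond j c →
          avgFamily (avOfRecord F N K) (γ t) j c = avgFamily (avOfRecord F N K) U j c) →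
          ∀ a : ℝ, HasDerivAt (fun t => wilsonAction4 (γ t)) a 0 → a = 0)
    (hPj : ∀ (j : ℕ) (c : PBond (F.P K) j), D.LamBond j c → Pj j) :
    ∀ γ : ℝ → GaugeField (F.P K) 0 (SU N), γ 0 = U →
      DifferentiableAt ℝ (fun (t : ℝ) (b : PBond (F.P K) 0) => ((γ t b : SU N) : Matrix (Fin N) (Fin N) ℂ)) 0 →
        (∀ (t : ℝ) (j : ℕ) (c : PBond (F.P K) j), Pj j → D.LamBond j c →
          avgFamily (avOfRecord F N K) (γ t) j c = avgFamily (avOfRecord F N K) U j c) →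
          HasDerivAt (fun t => wilsonAction4 (γ t)) 0 0 := by
  intro γ hγ0 hd hfib
  have hD := (differentiableAt_wilsonAction4_along hd).hasDerivAt
  have ha : deriv (fun t => wilsonAction4 (γ t)) 0 = 0 :=
    hcrit γ hγ0 hd (Filter.Eventually.of_forall fun t j c hc => hfib t j c (hPj j c hc) hc) _ hD
  rw [ha] at hD
  exact hD

end Forms

/-! ## §3  `R∂*H = 0` through a matrix kernel: the slice rows of `A + H·Z` -/

section Slice

variable {P : Params} (k : ℕ) (D : Domains P) {N : ℕ}

/-- **The real row of a matrix-kernel `H` is `flatH` of a real vector**: for `H X b = Σ_t ((κ_t·flatH(𝟙_t)(b) : ℝ) : ℂ)•X t` and a `ℂ`-linear functional `φ`,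
`Re φ(H X b) = flatH (t ↦ κ_t·Re φ(X t)) b`. [cite: Balaban1985Variational, (45) p.285; Balaban1984PropagatorsII, (2.35) p.228] -/
theorem re_apply_kernelH_eq_flatH (κ : BondIdx D → ℝ)
    (H : (BondIdx D → Matrix (Fin N) (Fin N) ℂ) →ₗ[ℂ] (PBond P 0 → Matrix (Fin N) (Fin N) ℂ))
    (hH : ∀ (X : BondIdx D → Matrix (Fin N) (Fin N) ℂ) (b : PBond P 0), H X b = ∑ t, (((κ t * flatH P k D (Pi.single t 1) b : ℝ) : ℂ)) • X t)
    (φ : Matrix (Fin N) (Fin N) ℂ →L[ℂ] ℂ) (X : BondIdx D → Matrix (Fin N) (Fin N) ℂ) (b : PBond P 0) :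
    (φ (H X b)).re = flatH P k D (fun t => κ t * (φ (X t)).re) b := by
  classical
  rw [hH, map_sum, Complex.re_sum]
  have hlin : flatH P k D (fun t => κ t * (φ (X t)).re) = ∑ t, (κ t * (φ (X t)).re) • flatH P k D (Pi.single t 1) := by
    have hv : (fun t => κ t * (φ (X t)).re) = ∑ t, (κ t * (φ (X t)).re) • (Pi.single t (1 : ℝ) : BondIdx D → ℝ) := by
      funext s
      simp only [Finset.sum_apply, Pi.smul_apply, Pi.single_apply, smul_eq_mul, mul_ite, mul_one, mul_zero,
        Finset.sum_ite_eq, Finset.mem_univ, if_true]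
    conv_lhs => rw [hv]
    rw [map_sum]
    refine Finset.sum_congr rfl fun t _ => ?_
    rw [map_smul]
  rw [hlin, Finset.sum_apply]
  refine Finset.sum_congr rfl fun t _ => ?_
  rw [map_smul, smul_eq_mul, Pi.smul_apply, smul_eq_mul, Complex.re_ofReal_mul]
  ring

/-- ★★ **(45) `R∂*(H X) = 0` FOR MATRIX KERNELS**: every real row `b ↦ Re φ(H X b)` of a matrix-kernel `H` (lattice factor `c = Lᵏ`) lies in the kernel of `R∂*`.
[cite: Balaban1985Variational, (45) p.285, (153) p.301; Balaban1984PropagatorsII, (2.34)–(2.35) p.228] -/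
theorem RE_dsE_re_kernelH_eq_zero (κ : BondIdx D → ℝ)
    (H : (BondIdx D → Matrix (Fin N) (Fin N) ℂ) →ₗ[ℂ] (PBond P 0 → Matrix (Fin N) (Fin N) ℂ))
    (hH : ∀ (X : BondIdx D → Matrix (Fin N) (Fin N) ℂ) (b : PBond P 0), H X b = ∑ t, (((κ t * flatH P k D (Pi.single t 1) b : ℝ) : ℂ)) • X t)
    (φ : Matrix (Fin N) (Fin N) ℂ →L[ℂ] ℂ) (X : BondIdx D → Matrix (Fin N) (Fin N) ℂ) :
    RE D ((P.L : ℝ) ^ k) (dsE ((P.L : ℝ) ^ k) (WithLp.toLp 2 fun b => (φ (H X b)).re : BondSpace P)) = 0 := by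
  have hfun : (fun b => (φ (H X b)).re) = flatH P k D (fun t => κ t * (φ (X t)).re) :=
    funext fun b => re_apply_kernelH_eq_flatH k D κ H hH φ X b
  rw [hfun]
  exact RE_dsE_hOp D (pow_ne_zero _ (Nat.cast_ne_zero.2 P.L_pos.ne')) (fun _ => one_pos) _

/-- ★★ **ADDING `H·Z` DOES NOT MOVE THE (153) SLICE ROWS**: `R∂*(Re φ(A + H Z)) = R∂*(Re φ A)` for every `ℂ`-linear `φ` (apply also to `−i•φ` for the imaginary rows).
[cite: Balaban1985Variational, (45) p.285, (153) p.301, (159) p.303; Balaban1984PropagatorsII, (2.34) p.228] -/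
theorem RE_dsE_re_add_kernelH (κ : BondIdx D → ℝ)
    (H : (BondIdx D → Matrix (Fin N) (Fin N) ℂ) →ₗ[ℂ] (PBond P 0 → Matrix (Fin N) (Fin N) ℂ))
    (hH : ∀ (X : BondIdx D → Matrix (Fin N) (Fin N) ℂ) (b : PBond P 0), H X b = ∑ t, (((κ t * flatH P k D (Pi.single t 1) b : ℝ) : ℂ)) • X t)
    (φ : Matrix (Fin N) (Fin N) ℂ →L[ℂ] ℂ) (A : PBond P 0 → Matrix (Fin N) (Fin N) ℂ) (Z : BondIdx D → Matrix (Fin N) (Fin N) ℂ) :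
    RE D ((P.L : ℝ) ^ k) (dsE ((P.L : ℝ) ^ k) (WithLp.toLp 2 fun b => (φ ((A + H Z) b)).re : BondSpace P)) =
      RE D ((P.L : ℝ) ^ k) (dsE ((P.L : ℝ) ^ k) (WithLp.toLp 2 fun b => (φ (A b)).re : BondSpace P)) := by
  have hsplit : (WithLp.toLp 2 fun b => (φ ((A + H Z) b)).re : BondSpace P) =
      (WithLp.toLp 2 fun b => (φ (A b)).re : BondSpace P) + (WithLp.toLp 2 fun b => (φ (H Z b)).re : BondSpace P) := by
    rw [← WithLp.toLp_add]
    congr 1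
    funext b
    rw [Pi.add_apply, Pi.add_apply, map_add, Complex.add_re]
  rw [hsplit, map_add, map_add, RE_dsE_re_kernelH_eq_zero k D κ H hH φ Z, add_zero]

end Slice

end Summit.QuantumFields.YangMills.BalabanUVNodes.N07DPrimeChartDictionary

end
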